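import Literature.AlgebraicGeometry.Motives.NumericalRankKunnethFullyAlgebraicFactor
import HarnessLib

/-!
# Numerically trivial classes and numerical ranks of `X × 𝐏ʳ` over a finite field:
# `dim N^c(X × 𝐏ʳ) = Σ_{q ≤ r} dim N^{c−q}(X)`, `ρ_c(X × 𝐏ʳ) = Σ_{q ≤ r} ρ_{c−q}(X)`

Topic `Literature/AlgebraicGeometry/Motives`; THEOREMS ONLY (no definition, no instance, no named fact;
D-0026).

Row g53-#9 computed, for a factor `Z` with fully algebraic cohomology, the dimension of the numerically
trivial `K`-classes `N^c(X × Z)` and the numerical rank `ρ_c(X × Z)` (the rank of the Poincaré pairing on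
`K·Aᶜ × K·A^{c′}`, the number in Tate's «order of the pole = rank») as `Σ_{p+q=c} (…)_p(X)·b_{2q}(Z)`.  For
`Z = 𝐏ʳ` over a finite field — in a Galois-compatible theory with the trace formula, `χ(φ_arith) = q` and RH
for `𝐏ʳ`, so that `b_{2q}(𝐏ʳ) = [q ≤ r]` and every class on `𝐏ʳ` is algebraic — the weights are `0` or `1`:
**`dim N^c(X × 𝐏ʳ) = Σ_{p+q=c, q≤r} dim N^p(X)`** (`finrank_numTrivialClasses_tensor_projectiveSpace`) and
**`ρ_c(X × 𝐏ʳ) = Σ_{p+q=c, q≤r} (dim K·Aᵖ(X) − dim N^p(X)) = Σ_{q≤r} ρ_{c−q}(X)`**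
(`finrank_range_cupPairing_tensor_projectiveSpace`; Kahn Prop. 6.12 for `∼ = num`: `A_num(X × 𝐏ʳ) ≃
⊕_{q≤r} A_num^{c−q}(X)`).  `N^p(X)` is written inline as in row g53-#9.

HC is not touched.

## References

* [Kahn2020] B. Kahn, *Zeta and L-Functions of Varieties and Motives* (2020), §6.4 Prop. 6.11 (6.4.1)–Prop. 6.12.
* [Fulton1998] W. Fulton, *Intersection Theory* (1998), Th. 3.3 (b).
* [TateWoodsHole1965] J. Tate, *Algebraic cycles and poles of zeta functions* (1965), §3 (12).
* [Hartshorne1977] R. Hartshorne, *Algebraic Geometry* (1977), App. C Ex. 5.2 (`b_{2q}(𝐏ʳ) = 1`).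
* Tree: row g53-#9 (`finrank_numTrivialClasses_tensor`, `finrank_range_cupPairing_tensor`),
  `ProjectiveSpaceFiniteFieldCohomology` (`finrank_projectiveSpace_two_mul`, `algebraicClasses_projectiveSpace_eq_top`,
  `finrank_projectiveSpace_of_odd`).

## Provenance

Lane `lit-hodgefound` (summit `HodgeConjecture`, Track 2 foundations library, Layer B: motives — numerical
equivalence on products), seat `lit-hodgefound-p29` (literature-prover, generation 53, row g53-#12).
-/

universe u v

open CategoryTheory AlgebraicGeometry MonoidalCategory CartesianMonoidalCategory
open Finset.HasAntidiagonal (antidiagonal mem_antidiagonal)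

namespace Literature.AlgebraicGeometry.Motives

namespace GaloisWeilCohomology

variable {k : Type u} [Field k] [Finite k] {K : Type v} [Field K] [CharZero K]
  {χ : Field.absoluteGaloisGroup k →* Kˣ} (E : GaloisWeilCohomology k K χ)
variable {n r : ℕ} {X : SchemeOver k}

/-- **`dim_K N^c(X × 𝐏ʳ) = Σ_{p+q=c, q≤r} dim_K N^p(X)`** (numerically trivial `K`-classes; finite field, RH for
`𝐏ʳ` in `E`). [cite: Kahn2020, §6.4 Prop. 6.11 (6.4.1) and Prop. 6.12] [cite: Hartshorne1977, App. C Ex. 5.2] -/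
theorem finrank_numTrivialClasses_tensor_projectiveSpace (hE : E.HasLefschetzTraceFormula)
    (hχ : ((χ (arithFrob k) : Kˣ) : K) = Nat.card k)
    (hRH : E.WeilRiemannHypothesisFor (projectiveSpace r k) r) (hX : IsSmoothProjective n X) (c : ℕ) :
    Module.finrank K ↥(E.algebraicClasses (X ⊗ projectiveSpace r k) c ⊓
        ⨅ (c' : ℕ), ⨅ (hc : 2 * c + 2 * c' = 2 * (n + r)),
          LinearMap.ker ((E.cupPairing (X ⊗ projectiveSpace r k) (n + r) (2 * c) (2 * c') hc).domRestrict₂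
            (E.algebraicClasses (X ⊗ projectiveSpace r k) c'))) =
      ∑ pq ∈ antidiagonal c, if pq.2 ≤ r then
        Module.finrank K ↥(E.algebraicClasses X pq.1 ⊓ ⨅ (p' : ℕ), ⨅ (hp : 2 * pq.1 + 2 * p' = 2 * n),
          LinearMap.ker ((E.cupPairing X n (2 * pq.1) (2 * p') hp).domRestrict₂ (E.algebraicClasses X p')))
        else 0 := by
  rw [E.finrank_numTrivialClasses_tensor hX (isSmoothProjective_projectiveSpace_holds k r)
    (E.algebraicClasses_projectiveSpace_eq_top hE hχ hRH) (fun _ hj ↦ E.finrank_projectiveSpace_of_odd hE hχ hRH hj) c]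
  refine Finset.sum_congr rfl fun pq _ ↦ ?_
  split_ifs with hq
  · rw [E.finrank_projectiveSpace_two_mul hE hχ hRH hq, mul_one]
  · haveI := E.subsingleton_obj (isSmoothProjective_projectiveSpace_holds k r) (i := 2 * pq.2) (by omega)
    have h0 : Module.finrank K (E.obj (projectiveSpace r k) (2 * pq.2)) = 0 := Module.finrank_zero_of_subsingleton
    rw [h0, mul_zero]

/-- **`ρ_c(X × 𝐏ʳ) = Σ_{p+q=c, q≤r} (dim K·Aᵖ(X) − dim N^p(X)) = Σ_{q≤r} ρ_{c−q}(X)`** (`c + c′ = n + r`): the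
numerical rank of `X × 𝐏ʳ` — the number in «order of the pole of `Z(X × 𝐏ʳ, T)` at `q^{−c}` = rank» — from
the ranks of `X` in the window `c − r ≤ p ≤ c` (row g53-#9's `ρ_p(X) = dim K·Aᵖ(X) − dim N^p(X)`).
[cite: Kahn2020, §6.4 Prop. 6.11 (6.4.1) and Prop. 6.12] [cite: TateWoodsHole1965, §3 (12)] [cite: Hartshorne1977, App. C Ex. 5.2] -/
theorem finrank_range_cupPairing_tensor_projectiveSpace (hE : E.HasLefschetzTraceFormula)
    (hχ : ((χ (arithFrob k) : Kˣ) : K) = Nat.card k)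
    (hRH : E.WeilRiemannHypothesisFor (projectiveSpace r k) r) (hX : IsSmoothProjective n X) {c c' : ℕ}
    (hcc' : c + c' = n + r) (h : 2 * c + 2 * c' = 2 * (n + r)) :
    Module.finrank K (LinearMap.range ((E.cupPairing (X ⊗ projectiveSpace r k) (n + r) (2 * c) (2 * c')
        h).domRestrict₁₂ (E.algebraicClasses (X ⊗ projectiveSpace r k) c)
          (E.algebraicClasses (X ⊗ projectiveSpace r k) c'))) =
      ∑ pq ∈ antidiagonal c, if pq.2 ≤ r then
        Module.finrank K (E.algebraicClasses X pq.1) -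
          Module.finrank K ↥(E.algebraicClasses X pq.1 ⊓ ⨅ (p' : ℕ), ⨅ (hp : 2 * pq.1 + 2 * p' = 2 * n),
            LinearMap.ker ((E.cupPairing X n (2 * pq.1) (2 * p') hp).domRestrict₂ (E.algebraicClasses X p')))
        else 0 := by
  rw [E.finrank_range_cupPairing_tensor hX (isSmoothProjective_projectiveSpace_holds k r)
    (E.algebraicClasses_projectiveSpace_eq_top hE hχ hRH) (fun _ hj ↦ E.finrank_projectiveSpace_of_odd hE hχ hRH hj)
    hcc' h]
  refine Finset.sum_congr rfl fun pq _ ↦ ?_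
  split_ifs with hq
  · rw [E.finrank_projectiveSpace_two_mul hE hχ hRH hq, mul_one]
  · haveI := E.subsingleton_obj (isSmoothProjective_projectiveSpace_holds k r) (i := 2 * pq.2) (by omega)
    have h0 : Module.finrank K (E.obj (projectiveSpace r k) (2 * pq.2)) = 0 := Module.finrank_zero_of_subsingleton
    rw [h0, mul_zero]

/-- **`ρ_c(X × 𝐏ʳ) = dim K·Aᶜ(X × 𝐏ʳ) = Σ_{p+q=c, q≤r} dim K·Aᵖ(X)` under hom = num on `X`** (`N^p(X) = 0` for
the `p` in the window). [cite: Kahn2020, §6.4 Prop. 6.12 and §6.12.2] [cite: Hartshorne1977, App. C Ex. 5.2] -/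
theorem finrank_range_cupPairing_tensor_projectiveSpace_of_forall_eq_bot (hE : E.HasLefschetzTraceFormula)
    (hχ : ((χ (arithFrob k) : Kˣ) : K) = Nat.card k)
    (hRH : E.WeilRiemannHypothesisFor (projectiveSpace r k) r) (hX : IsSmoothProjective n X) {c c' : ℕ}
    (hcc' : c + c' = n + r) (h : 2 * c + 2 * c' = 2 * (n + r))
    (hN : ∀ p q : ℕ, p + q = c →
      E.algebraicClasses X p ⊓ (⨅ (p' : ℕ), ⨅ (hp : 2 * p + 2 * p' = 2 * n),
        LinearMap.ker ((E.cupPairing X n (2 * p) (2 * p') hp).domRestrict₂ (E.algebraicClasses X p'))) = ⊥) :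
    Module.finrank K (LinearMap.range ((E.cupPairing (X ⊗ projectiveSpace r k) (n + r) (2 * c) (2 * c')
        h).domRestrict₁₂ (E.algebraicClasses (X ⊗ projectiveSpace r k) c)
          (E.algebraicClasses (X ⊗ projectiveSpace r k) c'))) =
      ∑ pq ∈ antidiagonal c, if pq.2 ≤ r then Module.finrank K (E.algebraicClasses X pq.1) else 0 := by
  rw [E.finrank_range_cupPairing_tensor_of_forall_eq_bot hX (isSmoothProjective_projectiveSpace_holds k r)
    (E.algebraicClasses_projectiveSpace_eq_top hE hχ hRH) (fun _ hj ↦ E.finrank_projectiveSpace_of_odd hE hχ hRH hj)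
    hcc' h hN, E.finrank_algebraicClasses_tensor_projectiveSpace hE hχ hRH hX c]

end GaloisWeilCohomology

end Literature.AlgebraicGeometry.Motives
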